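import Summits.QuantumFields.YangMills.Theses.StretchedTail
import Summits.QuantumFields.YangMills.Theses.ModerateWindow
import Summits.QuantumFields.YangMills.Theorems.SmallFieldWideningLargeFieldMassRefinementTailSubGaussianRung

/-!
# Routes `ModerateWindow` / `StretchedTail` (seat ym-r3-idea-2 g4): the HONEST NESTING of the two new cruxes on `UnitScaleTilt.HistoryTailL`

`ModerateWindow.WindowMGFL → StretchedTail.OrliczTailL`: the windowed sub-Gaussian MGF bound, evaluated at the single Laplace variable `t = 1`
(which lies in the window `[0, β_(K−j)^ε]` because `β_(K−j) ≥ 1` for `γ ≤ 1`), IS a `ψ₁`-Orlicz bound with `α = 1`, `C = 1` and constant `D·e^H`.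
So a proof of crux stmt-QuantumFields-27839 also closes crux stmt-QuantumFields-27836; the converse is not claimed.  Support file (structural edge);
neither crux, nor `HistoryTailL`, nor any rung or summit is proved here.
-/

namespace Summit.QuantumFields.YangMills.Theorems.ModerateWindowNesting

open MeasureTheory ProbabilityTheory Real
open Literature.MathematicalPhysics.QuantumFieldTheory.Balaban1983to89
open Literature.MathematicalPhysics.QuantumFieldTheory.Balaban1983to89.T4Continuum
open Literature.MathematicalPhysics.QuantumFieldTheory.Balaban1983to89.T3ContinuumYM3Torus
open Literature.MathematicalPhysics.QuantumFieldTheory.Balaban1983to89.T3UnitScaleTilt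
open Literature.MathematicalPhysics.QuantumFieldTheory.Balaban1983to89.T3UnitLawDensityEML
open Summit.QuantumFields.YangMills.Theorems.LargeFieldMassRefinementTailSubGaussianRung

/-- `β_n ≥ 1` along the scheme for `0 < γ ≤ 1`. [cite: Balaban1985UV3, (1)-(3) p.256] -/
theorem one_le_beta (F : T3Family) {γ : ℝ} (hγ : 0 < γ) (hγ1 : γ ≤ 1) (n : ℕ) : 1 ≤ (F.scheme ℰp γ).β n := by
  have hL : 1 ≤ F.L := F.hL.2.le
  have hL0 : 0 < F.L := hL
  show 1 ≤ (γ * (F.P n).eps)⁻¹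
  have heps : (F.P n).eps = ((F.L : ℝ)⁻¹) ^ n := rfl
  rw [heps]
  have hx : 0 < γ * ((F.L : ℝ)⁻¹) ^ n := mul_pos hγ (pow_pos (inv_pos.2 (by exact_mod_cast hL0)) n)
  have hx1 : γ * ((F.L : ℝ)⁻¹) ^ n ≤ 1 :=
    mul_le_one₀ hγ1 (pow_nonneg (inv_nonneg.2 (Nat.cast_nonneg _)) n)
      (pow_le_one₀ (inv_nonneg.2 (Nat.cast_nonneg _)) (inv_le_one_of_one_le₀ (by exact_mod_cast hL)))
  exact (one_le_inv₀ hx).2 hx1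

/-- **NESTING.** The windowed sub-Gaussian MGF crux of route `ModerateWindow` implies the `ψ_α`-Orlicz crux of route `StretchedTail` (with `α = 1`). -/
theorem orliczTailL_of_windowMGFL (h : Summit.QuantumFields.YangMills.Theses.ModerateWindow.WindowMGFL) :
    Summit.QuantumFields.YangMills.Theses.StretchedTail.OrliczTailL := by
  intro L
  obtain ⟨ε, hε, γ₁, hγ₁, hγ₁1, hF⟩ := h L
  refine ⟨1, one_pos, γ₁, hγ₁, hγ₁1, fun F γ hFL hγ hγle => ?_⟩
  obtain ⟨H, D, A, hH, hD, hb⟩ := hF F γ hFL hγ hγle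
  refine ⟨1, D * Real.exp H, A, one_pos, by positivity, fun K j hj hjK p => ?_⟩
  have hγ1 : γ ≤ 1 := hγle.trans hγ₁1
  have hβ1 : 1 ≤ (F.scheme ℰp γ).β (K - j) := one_le_beta F hγ hγ1 (K - j)
  have ht1 : (1 : ℝ) ≤ (F.scheme ℰp γ).β (K - j) ^ ε := Real.one_le_rpow hβ1 hε.le
  have key := hb K j hj hjK p 1 zero_le_one ht1
  have hL : 1 ≤ F.L := F.hL.2.le
  have hg : 0 < Real.sqrt (γ * ((F.L : ℝ)⁻¹) ^ (K - j)) := (T3ThresholdSmallness.sqrt_coupling_pos_le hL hγ (K - j)).1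
  have hfun : (fun U : GaugeField (F.P K) 0 (Matrix.specialUnitaryGroup (Fin 2) ℂ) =>
      Real.exp ((GaugeGroup.dist1 (GaugeField.plaqHol (Averaging.iter (fun i => BlockAveraging.blockAvg (P := F.P K) (j := i) ℰp) j U) p) /
        (1 * Real.sqrt (γ * ((F.L : ℝ)⁻¹) ^ (K - j)))) ^ (1 : ℝ))) =
      fun U => Real.exp (1 * (GaugeGroup.dist1 (GaugeField.plaqHol (Averaging.iter (fun i => BlockAveraging.blockAvg (P := F.P K) (j := i) ℰp) j U) p) /
        Real.sqrt (γ * ((F.L : ℝ)⁻¹) ^ (K - j)))) := by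
    funext U
    rw [Real.rpow_one, one_mul, one_mul]
  haveI := isProbabilityMeasure_gibbsK F ℰp hγ.le K
  refine ⟨?_, ?_⟩
  · rw [hfun]
    exact integrable_exp_mul_dist1_iter F K j p (gibbsK F ℰp γ K) hg zero_le_one
  · rw [hfun]
    calc ∫ U, Real.exp (1 * (GaugeGroup.dist1 (GaugeField.plaqHol (Averaging.iter (fun i => BlockAveraging.blockAvg (P := F.P K) (j := i) ℰp) j U) p) /
            Real.sqrt (γ * ((F.L : ℝ)⁻¹) ^ (K - j)))) ∂(gibbsK F ℰp γ K)
          ≤ D * (F.scheme ℰp γ).β (K - j) ^ A * Real.exp (H * 1 ^ 2) := key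
      _ = D * Real.exp H * (F.scheme ℰp γ).β (K - j) ^ A := by rw [one_pow, mul_one]; ring

end Summit.QuantumFields.YangMills.Theorems.ModerateWindowNesting
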